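import Summits.CriticalPhenomena.PercolationContinuityZ3.Theses.PercNearOneGluing
import Literature.Probability.Percolation.PercolationEvents
import HarnessLib.Audit
import Summits.CriticalPhenomena.PercolationContinuityZ3.Theorems.PercNearOneGluingNearOneGluingVariants2415

/-! TTRL-lite variant V2434 of stmt-CriticalPhenomena-4574

(`stub_shorteningStep` of line `kn_shortening_induction`, move `specialise+small_case`:
`n := 4` and `A.card = 1`).  With a single relay `A = {a₀}` the shortening step reads
`μ₁(v ↔ a₀) · μ₁(a₀ ↔ b) ≤ μ₁(v ↔ b)` for the glued measure `μ₁ = prodBernoulli (w[s(v,x) ↦ 1])`,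
which is Harris' inequality plus transitivity of open connection.  Formally it is the special
case `A.card = 1 ≤ 2`, `n = 4` of the already-landed sibling variant V2415
(`stub_shorteningStep_var2415`: `A.card ≤ 2`, any `n`; Kozma–Nitzan's shortening step,
Conjecture 6 of arXiv:2401.12397 measured against the minimiser `a₀`, for at most two relays).
No new definitions, no named facts; the displayed induction hypothesis is not used. -/

namespace Summit.CriticalPhenomena.PercolationContinuityZ3.Theorems

open MeasureTheory Set Literature.Probability.LatticeModels Literature.Probability.Percolation
open scoped Classical BigOperators

/-- TTRL-lite variant V2434 of `stub_shorteningStep` (stmt-CriticalPhenomena-4574, Kozma–Nitzan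
Conjecture 6 with the induction hypothesis displayed): the shortening step
`μ₁(⋃ a ∈ A, v ↔ a) · μ₁(a₀ ↔ b) ≤ μ₁(v ↔ b)` for the glued measure
`μ₁ = prodBernoulli (w[s(v,x) ↦ 1])` on `Fin 4` with exactly one relay (`A.card = 1`).
Immediate from the sibling variant `stub_shorteningStep_var2415` (case `A.card ≤ 2`, any `n`)
at `n = 4`, since `A.card = 1 ≤ 2`. -/
theorem stub_shorteningStep_var2434 : ∀ (w : Sym2 (Fin 4) → unitInterval) (A : Finset (Fin 4)) (b v x a₀ : Fin 4), A.card = 1 → v ∉ A → v ≠ x → w s(v, x) = 0 → a₀ ∈ A → (∀ a ∈ A, (prodBernoulli w).real (openConn a₀ b) ≤ (prodBernoulli w).real (openConn a b)) → (∀ w' : Sym2 (Fin 4) → unitInterval, (∀ e, w e = 0 → w' e = 0) → ∀ (A' : Finset (Fin 4)) (o' b' : Fin 4) (t : ℝ), (∀ a ∈ A', t ≤ (prodBernoulli w').real (openConn a b')) → (prodBernoulli w').real (⋃ a ∈ A', openConn o' a) * t ≤ (prodBernoulli w').real (openConn o' b')) → (prodBernoulli (Function.update w s(v, x) 1)).real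 (⋃ a ∈ A, openConn v a) * (prodBernoulli (Function.update w s(v, x) 1)).real (openConn a₀ b) ≤ (prodBernoulli (Function.update w s(v, x) 1)).real (openConn v b) := by
  intro w A b v x a₀ hcard
  exact stub_shorteningStep_var2415 4 w A b v x a₀ (by omega)

end Summit.CriticalPhenomena.PercolationContinuityZ3.Theorems
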